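import Summits.BirchSwinnertonDyer.BirchSwinnertonDyer.Theorems.Rank2Observatory2DescClSubCurveCertE2Defs
import Summits.BirchSwinnertonDyer.BirchSwinnertonDyer.Theorems.Rank2Observatory2DescClKillCurveCertE2VDefs
import HarnessLib

/-!
# BirchSwinnertonDyer — rank ≥ 2 observatory: KERNEL-2DESC-CL v3.8, E2SV — two-view (η-family) subgroup-sieve certificates with a kill SET in VALIDITY form, part 1/3: the checker

HONEST FRAMING: per-curve certified theorems and census instruments; no claim on BSD in rank ≥ 2.

Part 1 of 3.  The v2.8 subgroup-sieve rows (`Rank2Observatory2DescClSubCurveCertE2*`, E2KS; tranche E of the census: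
SIXTEEN admissible classes, a rank-2 certificate needs a kill SET meeting every `∆`-closed family of eight) carry each
kill as ONE residue-tree Boolean `killCheck p … fuel` at a prime `p ∈ killPrimes = [2, …, 23]`; 82 complex (+ 11 real)
curves of that tranche have NO sufficient kill set of that shape (`census/coverage/cl_frontier_v3`).  Exactly as v3.7
E2V (`Rank2Observatory2DescClKillCurveCertE2VDefs`) re-typed the kill hypothesis of the eight-class rows, this layer
re-types the kill hypothesis of the subgroup-sieve rows as the shape-independent PROPOSITION `KillValidE2 F cc ks`
(every listed kill prime is prime and its class is `TwoDescKill.KillValidAt`-insoluble there), so that kills at ANY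
prime and in ANY certificate shape (quartic-model residue trees `qkCert`, norm conics `conicCert`, linear depth 2, …)
feed the subgroup sieve:

* `checkE2KSV F cc r ks sv` — `checkE2KS` with the light clause `ClKillE2.liteV` (no prime list) for `lite`, clause
  for clause; the kill records, the sieve `admE2K`, the survivor list `sv`, `liveE2KS` and the search `noSubB` are the
  E2KS ones, unchanged (imported).

The validity-form glue (`killListCheckV_of_liteE2V`, `killValid_entries_of_killValidE2`, `noTrivial_of_liteE2V`) is
the E2V one (imported).  Text = `Rank2Observatory2DescClSubCurveCertE2Defs` by the substitution script
`generics/e2v/tools/mk_se2v.py`.  New declarations only; sorry-free.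
[cite: Cassels1991LecturesEllipticCurves, §15] [cite: CremonaAlgorithms1997, §3.6]
-/

set_option linter.dupNamespace false

noncomputable section

open scoped Classical NumberField nonZeroDivisors

open Literature.NumberTheory.NumberFields Polynomial Module NumberField IsDedekindDomain Ideal

namespace Summit.BirchSwinnertonDyer.BirchSwinnertonDyer.Rank2Observatory.TwoDescCl

open TwoDescCubic ClFieldCert TwoDescKill

section Checkers

variable (F : ClFieldCertE2) (cc : ClCurveCertE2)

/-- **The two-view per-curve `r`-checker with a kill list and the SUBGROUP SIEVE, validity form**: `checkE2KS F cc r ks sv`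
with the light clause `liteV` (no prime list) in place of `lite` — the clauses of `checkE2K F cc r ks`
except its count, verbatim; then: every class passing `admE2K` is listed in `sv` (`2^n` sieve evaluations, as the old
count), and the subgroup-sieve search `noSubB` of depth `r + 1` over the live classes — pure list arithmetic — succeeds.
Computable; run by `decide +kernel`. [cite: Cassels1991LecturesEllipticCurves, §15] [cite: CremonaAlgorithms1997, §3.6] -/
def checkE2KSV (r : ℕ) (ks : List ClKillE2) (sv : List (List ℕ)) : Bool :=
  decide (deltaShort cc.A cc.B cc.C ≠ 0) &&
    noRootMod cc.pF cc.A cc.B cc.C &&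
    decide (cubicAtCoords F.fe.base.a F.fe.base.b F.fe.base.c ((F.m₁ : ℤ) * cc.A) ((F.m₁ : ℤ) ^ 2 * cc.B)
      ((F.m₁ : ℤ) ^ 3 * cc.C) cc.Xt = (0, 0, 0)) &&
    decide (derivAtCoords F.fe.base.a F.fe.base.b F.fe.base.c ((F.m₁ : ℤ) * cc.A) ((F.m₁ : ℤ) ^ 2 * cc.B) cc.Xt =
      MonicCubic.mulCoords F.fe.base.a F.fe.base.b F.fe.base.c (smulCoords (F.m₁ : ℤ) cc.XD)
        (prodPowCoords F.fe.base.a F.fe.base.b F.fe.base.c [])) &&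
    twoViewCheck F.fe.base.a F.fe.base.b F.fe.base.c F.fe.u F.fe.d F.m₁ F.m₂ cc.Xt cc.Yt &&
    twoViewCheck F.fe.base.a F.fe.base.b F.fe.base.c F.fe.u F.fe.d F.m₁ F.m₂ cc.XD cc.YD &&
    decide (MonicCubic.disc cc.A cc.B cc.C < 0) &&
    decide (normFormZ F.fe.base.a F.fe.base.b F.fe.base.c cc.XD.1 cc.XD.2.1 cc.XD.2.2 ≠ 0) &&
    decide ((normFormZ F.fe.base.a F.fe.base.b F.fe.base.c cc.XD.1 cc.XD.2.1 cc.XD.2.2).natAbs =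
      (cc.dn.map fun pe => pe.1 ^ pe.2).prod) &&
    (cc.dn.all fun pe => primeDispatch F cc cc.XD cc.YD cc.dinvA cc.dinvE pe.1) &&
    (cc.codes.all fun bc => codeClause F cc bc) &&
    invCert F.fe.base.a F.fe.base.b F.fe.base.c F.fe.base.w₁ cc.XD cc.dW1 &&
    invCert F.fe.base.a F.fe.base.b F.fe.base.c F.fe.base.w₂ cc.XD cc.dW2 &&
    (cc.Q.all fun q => decide (0 < q)) &&
    decide (cc.head.length = 4) &&
    ((fam2 cc).all fun f => famCheckE2 F cc f) &&
    decide (∀ T : Finset (Fin (fam2 cc).length), T ≠ ∅ →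
      ∃ k : Fin (F.fe.base.chars.length + 3), Odd (T.filter fun j => bit2 F cc k j = true).card) &&
    (ks.all fun k => k.liteV F cc) &&
    decide (∀ U : Finset (Fin (fam2 cc).length), admE2K F cc ks ∅ U = true → U ∈ sv.map (survCls cc)) &&
    noSubB (fun U => decide (U ∈ liveE2KS F cc ks sv)) (liveE2KS F cc ks sv) (r + 1) [∅]

end Checkers

end Summit.BirchSwinnertonDyer.BirchSwinnertonDyer.Rank2Observatory.TwoDescCl

end
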